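import Literature.Probability.LatticeModels.TransferOperator
import Literature.Probability.LatticeModels.IsingThermodynamics
import Literature.Probability.LatticeModels.GKSInequalities
import Literature.MathematicalPhysics.QuantumFieldTheory.LatticeMassGap
import HarnessLib

/-!
# The Osterwalder–Schrader transfer realisation of the Ising plus state along a lattice axis

Vocabulary of the critical-Ising routes (`CriticalPhenomena/Ising3DConformalLimit`, route
`ThresholdDilation`, item `TwoPlaneTransferRealisation` = `stmt-CriticalPhenomena-6321`; cards
`quarter-turns-have-positive-roots`, `rotations-are-boosts-modular`, `modular-timelike-kms-moebius`,
`mirror-hoelder-modulus`, and the axis Källén–Lehmann representation `stmt-CriticalPhenomena-6328`).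

For the nearest-neighbour Ising model on `ℤ^d` the infinite-volume plus state `⟨·⟩⁺_{β,h}` is
reflection positive with respect to BOTH families of lattice hyperplanes orthogonal to the time
axis `e₀` — through sites, `x₀ = k`, and through bonds, `x₀ = k + ½` (Fröhlich–Israel–Lieb–Simon
1978, §2–3; in the tree on tori: `isingTorus_reflectionPositive_sites_holds`,
`isingTorus_reflectionPositive_bonds_holds`) — and translation invariant. The Osterwalder–Schrader
reconstruction along `e₀` (Glimm–Jaffe 1987, §6.1, Thm. 6.1.3 and the Remark "Transfer matrix of
statistical physics": `K^t = T(t)^`, `0 ≤ K ≤ I`, `K Ω = Ω`) then produces a Hilbert space `ℋ`, a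
map `ι` from bounded observables measurable in the closed half-space `{x₀ ≥ 0}` to `ℋ` whose Gram
form is the SITE-reflected pairing `⟪ι F, ι G⟫ = ∫ conj (F ∘ θ₀) · G dμ⁺`
(`θ₀ : x₀ ↦ -x₀`, so that time-zero observables embed isometrically: `F ∘ θ₀ = F` on `{x₀ = 0}`),
and a POSITIVE self-adjoint contraction `T` implementing the unit time shift (positivity of the odd
powers of `T` is exactly bond-reflection positivity), with `ι 1 = Ω`, `T Ω = Ω`.

This file fixes that notion as the `Prop`-valued structure

* **`IsingAxisOSRealisation d β h μ ι D`**: `μ` is a probability measure on `{±1}^{ℤ^d}` with the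
  plus correlations `∫ σ_A dμ = ⟨σ_A⟩⁺_{β,h} = plusCorr d β h A` (these determine `μ`: it is the plus
  state `μ⁺_{β,h}` of `exists_plusMeasure`, Friedli–Velenik 2017 Thm. 3.17 / Lemma 3.19), and
  `(ℋ, ι, D)` is an OS realisation of `μ` in the sense of the tree's hypothesis structure
  `IsOSRealisation μ (configReflect (siteTimeReflection d)) (latticeTimeShift d ℤˣ) (positiveTimeEvents d ℤˣ) ι D`
  (`TransferOperator.lean`; lattice time data from `LatticeMassGap.lean`, the site reflection
  `siteTimeReflection d` is new here), with `D : TransferData ℋ` (positive contraction `D.T`,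
  unit vacuum `D.vacuum`);

and proves its **working consequence** for the routes: with the complex spin observables
`spinObs A = σ_A` and the vectors `ψ_A = ι σ_A`,

* `IsingAxisOSRealisation.inner_spinObs_transfer_pow`: for finite `A, B ⊆ {x₀ ≥ 0}` and `n : ℕ`,
  `⟪ψ_A, Tⁿ ψ_B⟫ = ⟨σ_{θ₀ A ∆ (B + n e₀)}⟩⁺_{β,h}` (`σ² = 1` turns the product into the spin product
  of the symmetric difference), and `…_of_timeZero`: `⟪ψ_A, Tⁿ ψ_B⟫ = ⟨σ_{A ∆ (B + n e₀)}⟩⁺_{β,h}`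
  for `A` in the time-zero plane — the axis two-point function as a matrix element of `Tⁿ`
  (Glimm–Jaffe (6.1.12d)); in particular `n ↦ ⟨σ_0 σ_{n e₀}⟩⁺` is a moment sequence of the
  spectral measure of `T` in `ψ_{{0}}` (Källén–Lehmann along the axis, Glimm–Jaffe 1976 Prop. 2.2).

## Existence

The EXISTENCE of an `IsingAxisOSRealisation` (the content of the notion for the routes) is the
Osterwalder–Schrader reconstruction theorem applied to site- and bond-reflection positivity of the
plus state; it is proved in the companion files (`OSReconstruction.lean`: the abstract
reconstruction `IsOSReconstructible.isOSRealisation` from a reflection-positive, shift-symmetric,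
shift-positive OS form; the lattice/Ising specialisation from `IsReflectionPositive` for
`siteTimeReflection d` and `latticeTimeReflection d` on `positiveTimeSites d`). Nothing in this file
is asserted without proof; there are no named facts here.

## Design

* The time axis is the coordinate `0 : Fin d` (`[NeZero d]`), as in `LatticeMassGap.lean`, whose
  `positiveTimeSites d = {x | 0 ≤ x 0}`, `positiveTimeEvents d S` (the cylinder σ-algebra of the
  closed half-space) and `latticeTimeShift d S` (`σ ↦ σ (· + e₀)`, the sign for which `ι (G ∘ shift)
  = T (ι G)` maps positive-time observables to positive-time observables) are reused; only the
  reflection differs: `LatticeMassGap` realises the BOND reflection `x₀ ↦ -1 - x₀`, here the Gram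
  form is the SITE reflection `x₀ ↦ -x₀` (the routes need time-zero vectors `ψ_A` with
  `⟪ψ_A, Tⁿ ψ_B⟫ = ⟨σ_A σ_{B + n e₀}⟩⁺` without doubling of the time separation).
* The state enters through its correlations `spinCorr μ = plusCorr d β h` (the tree's plus state is
  the limit functional `plusExpect`, Friedli–Velenik Thm. 3.17; a probability measure with these
  correlations is unique, `measure_eq_of_forall_spinCorr_eq`), so the structure has the measure `μ`
  as an explicit parameter and no DLR field.
* Mathlib has no OS reconstruction / transfer-operator / Gibbs-state vocabulary (searched:
  `Osterwalder`, `transfer`, `reflection positiv`); everything used is from the tree.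

## References

* J. Glimm, A. Jaffe, *Quantum Physics: a functional integral point of view*, 2nd ed. (Springer
  1987), §6.1, Thm. 6.1.3 and Remark "Transfer matrix of statistical physics". [GlimmJaffe1987]
* J. Fröhlich, R. Israel, E. H. Lieb, B. Simon, *Phase transitions and reflection positivity. I*,
  Comm. Math. Phys. 62 (1978) 1–34, §2–3. [FILS1978]
* J. Glimm, A. Jaffe, *Critical exponents and elementary particles*, Comm. Math. Phys. 52 (1977)
  203–209, Prop. 2.2 (spectral representation of the transfer matrix).
* S. Friedli, Y. Velenik, *Statistical Mechanics of Lattice Systems* (CUP 2017), Thm. 3.17,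
  Lemma 3.19. [FriedliVelenik2017]
-/

noncomputable section

open MeasureTheory
open scoped InnerProductSpace ComplexConjugate symmDiff
open Literature.MathematicalPhysics.QuantumFieldTheory

namespace Literature.Probability.LatticeModels

variable (d : ℕ) [NeZero d]

/-! ### The site reflection `θ₀ : x₀ ↦ -x₀` -/

/-- The **time reflection through sites** of `ℤ^d`: `x₀ ↦ -x₀`, other coordinates fixed — the
reflection in the lattice hyperplane `{x₀ = 0}`, which it fixes pointwise, exchanging `{x₀ ≥ 0}`
with `{x₀ ≤ 0}` (Fröhlich–Israel–Lieb–Simon 1978 §2, reflection "through sites"; the torus version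
is the tree's `Torus.reflectThroughSites i 0`, the bond version `latticeTimeReflection d`).
Time is the coordinate `0 : Fin d`. [cite: FILS1978, §2] -/
def siteTimeReflection : Site d ≃ Site d where
  toFun x := Function.update x 0 (-x 0)
  invFun x := Function.update x 0 (-x 0)
  left_inv x := by ext j; by_cases hj : j = 0 <;> simp [hj]
  right_inv x := by ext j; by_cases hj : j = 0 <;> simp [hj]

/-- Pointwise formula for the site reflection. [cite: FILS1978, §2] -/
@[simp] theorem siteTimeReflection_apply (x : Site d) :
    siteTimeReflection d x = Function.update x 0 (-x 0) := rfl

/-- The site reflection is an involution. [cite: FILS1978, §2] -/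
theorem siteTimeReflection_involutive : Function.Involutive (siteTimeReflection d) :=
  (siteTimeReflection d).left_inv

/-- The site reflection fixes the time-zero hyperplane `{x₀ = 0}` pointwise. [cite: FILS1978, §2] -/
theorem siteTimeReflection_of_apply_zero {x : Site d} (hx : x 0 = 0) : siteTimeReflection d x = x := by
  ext j
  by_cases hj : j = 0
  · subst hj; simp [hx]
  · simp [hj]

/-- The site reflection maps the closed positive half `{x₀ ≥ 0}` onto the closed negative half
`{x₀ ≤ 0}`; the two halves meet in the reflection plane `{x₀ = 0}` (FILS 1978 §2: for reflections
through sites `Λ₊ ∩ Λ₋ = P`). [cite: FILS1978, §2] -/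
theorem siteTimeReflection_image_positiveTimeSites :
    siteTimeReflection d '' positiveTimeSites d = {x | x 0 ≤ 0} := by
  rw [Equiv.image_eq_preimage_symm]
  ext x
  simp only [positiveTimeSites, Set.mem_preimage, Set.mem_setOf_eq]
  change 0 ≤ Function.update x 0 (-x 0) 0 ↔ x 0 ≤ 0
  simp only [Function.update_self]
  omega

/-! ### Complex spin observables -/

variable {d}

/-- The **complex spin observable** `σ_A : σ ↦ ∏_{x ∈ A} σ_x ∈ {±1} ⊆ ℂ` of a finite set of sites
(the observables `A ∈ ℰ₊` whose OS vectors `ψ_A = ι σ_A = A^` span the transfer-matrix picture;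
Glimm–Jaffe 1987 §6.1 Remark, fields `ξ_x` on the lattice). [cite: GlimmJaffe1987, §6.1 Remark (Transfer matrix of statistical physics)] -/
def spinObs {V : Type*} (A : Finset V) : SpinConfig V → ℂ := fun σ => (spinProduct A σ : ℂ)

/-- Unfolding `spinObs`. [folklore] -/
@[simp] theorem spinObs_apply {V : Type*} (A : Finset V) (σ : SpinConfig V) :
    spinObs A σ = (spinProduct A σ : ℂ) := rfl

/-- `σ_∅ = 1`. [folklore] -/
@[simp] theorem spinObs_empty {V : Type*} : spinObs (∅ : Finset V) = 1 := by
  funext σ; simp [spinObs]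

/-- `‖σ_A‖ = 1`. [folklore] -/
theorem norm_spinObs {V : Type*} (A : Finset V) (σ : SpinConfig V) : ‖spinObs A σ‖ = 1 := by
  rw [spinObs_apply, Complex.norm_real, Real.norm_eq_abs, abs_spinProduct]

/-- A spin `σ_x` with `x` in the positive half is measurable for the positive-time σ-algebra. [folklore] -/
theorem measurable_positiveTimeEvents_spinAt {x : Site d} (hx : x ∈ positiveTimeSites d) :
    Measurable[positiveTimeEvents d ℤˣ] (spinAt x) :=
  (measurable_of_countable (fun u : ℤˣ => ((u : ℤ) : ℝ))).comp
    (measurable_cylinderEvent_apply (X := fun _ : Site d => ℤˣ) hx)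

/-- A spin product `σ_A` with `A` in the positive half is measurable for the positive-time
σ-algebra (it depends only on spins in `{x₀ ≥ 0}`; Glimm–Jaffe's `A ∈ ℰ₊`). [cite: GlimmJaffe1987, §6.1 (the algebra ℰ₊)] -/
theorem measurable_positiveTimeEvents_spinProduct {A : Finset (Site d)}
    (hA : (↑A : Set (Site d)) ⊆ positiveTimeSites d) :
    Measurable[positiveTimeEvents d ℤˣ] (spinProduct A) := by
  unfold spinProduct
  exact Finset.measurable_prod _ fun x hx => measurable_positiveTimeEvents_spinAt (hA hx)

/-- `σ_A` with `A ⊆ {x₀ ≥ 0}` is a bounded positive-time observable (`IsBoundedMeasurable`, the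
domain of the OS map `ι`). [cite: GlimmJaffe1987, §6.1 (the algebra ℰ₊)] -/
theorem isBoundedMeasurable_spinObs {A : Finset (Site d)} (hA : (↑A : Set (Site d)) ⊆ positiveTimeSites d) :
    IsBoundedMeasurable (positiveTimeEvents d ℤˣ) (spinObs A) :=
  ⟨Complex.measurable_ofReal.comp (measurable_positiveTimeEvents_spinProduct hA), 1,
    fun σ => (norm_spinObs A σ).le⟩

/-- Spin products under the site reflection of configurations: `σ_A (σ ∘ θ₀) = σ_{θ₀ A} (σ)`. [folklore] -/
theorem spinProduct_configReflect_siteTimeReflection [DecidableEq (Site d)] (A : Finset (Site d))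
    (σ : SpinConfig (Site d)) :
    spinProduct A (configReflect (siteTimeReflection d) σ) = spinProduct (A.image (siteTimeReflection d)) σ := by
  rw [spinProduct, spinProduct, Finset.prod_image fun x _ y _ hxy => (siteTimeReflection d).injective hxy]
  rfl

/-- Iterates of the unit time shift: `(shift^[n] σ) x = σ (x + n e₀)`. [folklore] -/
theorem latticeTimeShift_iterate_apply {S : Type*} [MeasurableSpace S] (n : ℕ) (σ : Site d → S) (x : Site d) :
    (latticeTimeShift d S)^[n] σ x = σ (x + Pi.single 0 (n : ℤ)) := by
  induction n generalizing x with
  | zero => simp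
  | succ n ih =>
    rw [Function.iterate_succ_apply', latticeTimeShift_apply, ih]
    congr 1
    rw [add_assoc, ← Pi.single_add]
    push_cast
    ring_nf

/-- Spin products under iterated time shifts: `σ_B (shift^[n] σ) = σ_{B + n e₀} (σ)`. [folklore] -/
theorem spinProduct_latticeTimeShift_iterate [DecidableEq (Site d)] (n : ℕ) (B : Finset (Site d))
    (σ : SpinConfig (Site d)) :
    spinProduct B ((latticeTimeShift d ℤˣ)^[n] σ) =
      spinProduct (B.image fun x => x + Pi.single 0 (n : ℤ)) σ := by
  rw [spinProduct, spinProduct, Finset.prod_image fun x _ y _ hxy => add_right_cancel hxy]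
  refine Finset.prod_congr rfl fun x _ => ?_
  simp only [spinAt, latticeTimeShift_iterate_apply]

/-! ### The notion -/

variable (d)
variable {H : Type*} [NormedAddCommGroup H] [InnerProductSpace ℂ H] [CompleteSpace H]

/-- **Osterwalder–Schrader transfer realisation of the Ising plus state along the axis `e₀`.**
`IsingAxisOSRealisation d β h μ ι D` says: `μ` is a probability measure on `{±1}^{ℤ^d}` whose
correlations are the plus-state correlations, `∫ σ_A dμ = ⟨σ_A⟩⁺_{β,h} = plusCorr d β h A` for all
finite `A` (so `μ` is the plus state `μ⁺_{β,h}`, which these determine; Friedli–Velenik 2017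
Thm. 3.17, Lemma 3.19), and the complex Hilbert space `H` with the map `ι` and the transfer data
`D = (T, Ω)` realise the OS reconstruction of `μ` along the time axis `0 : Fin d` with respect to
the SITE reflection `θ₀ : x₀ ↦ -x₀`:
`⟪ι F, ι G⟫ = ∫ conj (F ∘ θ₀) · G dμ` for bounded observables `F, G` measurable in `{x₀ ≥ 0}`,
`ι (G ∘ shift) = T (ι G)` for the unit shift `σ ↦ σ(· + e₀)` with `T ≥ 0`, `‖T‖ ≤ 1`
(`TransferData`), `ι 1 = Ω`, `T Ω = Ω`, dense range (Glimm–Jaffe 1987, §6.1, Thm. 6.1.3 and Remark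
"Transfer matrix of statistical physics"; positivity of the Gram form is reflection positivity
through sites, positivity of `T` reflection positivity through bonds, FILS 1978 §2–3). Existence
for the nearest-neighbour model (`β ≥ 0`, `h = 0`, every `d ≥ 1`; in particular at
`β = criticalBeta d`) is the OS reconstruction theorem, proved in the companion files. [cite: GlimmJaffe1987, §6.1  Theorem 6.1.3] -/
structure IsingAxisOSRealisation (β h : ℝ) (μ : Measure (SpinConfig (Site d)))
    (ι : (SpinConfig (Site d) → ℂ) → H) (D : TransferData H) : Prop where
  /-- The realised state is a probability measure. -/
  isProbabilityMeasure : IsProbabilityMeasure μ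
  /-- Its correlations are the plus-state correlations `⟨σ_A⟩⁺_{β,h}`. -/
  spinCorr_eq : ∀ A : Finset (Site d), spinCorr μ A = plusCorr d β h A
  /-- `(H, ι, D)` realises the OS reconstruction of `μ` along `e₀` for the site reflection. -/
  isOSRealisation : IsOSRealisation μ (configReflect (siteTimeReflection d)) (latticeTimeShift d ℤˣ)
    (positiveTimeEvents d ℤˣ) ι D

namespace IsingAxisOSRealisation

variable {d}
variable {β h : ℝ} {μ : Measure (SpinConfig (Site d))} {ι : (SpinConfig (Site d) → ℂ) → H}
  {D : TransferData H}

omit [CompleteSpace H] in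
/-- **Matrix elements of `Tⁿ` between spin vectors are plus correlations**: for finite
`A, B ⊆ {x₀ ≥ 0}`, `⟪ι σ_A, Tⁿ ι σ_B⟫ = ∫ σ_{θ₀A} σ_{B + n e₀} dμ = ⟨σ_{θ₀ A ∆ (B + n e₀)}⟩⁺_{β,h}`
(Glimm–Jaffe (6.1.12d) `⟪A^, e^{-tH} B^⟫ = ⟨θA, T(t) B⟩`, with `σ_C σ_{C'} = σ_{C ∆ C'}`). [cite: GlimmJaffe1987, §6.1  Theorem 6.1.3] -/
theorem inner_spinObs_transfer_pow [DecidableEq (Site d)] (hR : IsingAxisOSRealisation d β h μ ι D)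
    {A B : Finset (Site d)} (hA : (↑A : Set (Site d)) ⊆ positiveTimeSites d)
    (hB : (↑B : Set (Site d)) ⊆ positiveTimeSites d) (n : ℕ) :
    ⟪ι (spinObs A), (D.T ^ n) (ι (spinObs B))⟫_ℂ =
      (plusCorr d β h (A.image (siteTimeReflection d) ∆ B.image fun x => x + Pi.single 0 (n : ℤ)) : ℂ) := by
  rw [← hR.isOSRealisation.integral_conj_comp_reflect_mul_comp_iterate (isBoundedMeasurable_spinObs hA)
    (isBoundedMeasurable_spinObs hB) n, ← hR.spinCorr_eq, spinCorr, ← integral_complex_ofReal]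
  refine integral_congr_ae (ae_of_all _ fun σ => ?_)
  dsimp only
  rw [spinObs_apply, spinObs_apply, Complex.conj_ofReal, ← Complex.ofReal_mul,
    spinProduct_configReflect_siteTimeReflection, spinProduct_latticeTimeShift_iterate,
    spinProduct_mul_eq_spinProduct_symmDiff]

omit [CompleteSpace H] in
/-- **Time-zero form**: for finite `A ⊆ {x₀ = 0}` and `B ⊆ {x₀ ≥ 0}`,
`⟪ι σ_A, Tⁿ ι σ_B⟫ = ⟨σ_{A ∆ (B + n e₀)}⟩⁺_{β,h}`; for `A, B` both in the time-zero plane this is the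
transfer-matrix formula `⟪ψ_A, Tⁿ ψ_B⟫ = ⟨σ_A σ_{B + n e₀}⟩⁺_{β,h}` wanted by
`TwoPlaneTransferRealisation` (Glimm–Jaffe §6.1 Remark; Glimm–Jaffe 1977 Prop. 2.2). [cite: GlimmJaffe1987, §6.1 Remark (Transfer matrix of statistical physics)] -/
theorem inner_spinObs_transfer_pow_of_timeZero [DecidableEq (Site d)]
    (hR : IsingAxisOSRealisation d β h μ ι D) {A B : Finset (Site d)} (hA : ∀ x ∈ A, x 0 = 0)
    (hB : (↑B : Set (Site d)) ⊆ positiveTimeSites d) (n : ℕ) :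
    ⟪ι (spinObs A), (D.T ^ n) (ι (spinObs B))⟫_ℂ =
      (plusCorr d β h (A ∆ B.image fun x => x + Pi.single 0 (n : ℤ)) : ℂ) := by
  have hA' : (↑A : Set (Site d)) ⊆ positiveTimeSites d := fun x hx => by
    simp only [positiveTimeSites, Set.mem_setOf_eq, hA x hx, le_refl]
  rw [hR.inner_spinObs_transfer_pow hA' hB n]
  congr 3
  rw [Finset.image_congr (g := id) fun x hx => ?_, Finset.image_id]
  exact siteTimeReflection_of_apply_zero d (hA x (by simpa using hx))

omit [CompleteSpace H] in
/-- The Gram form on time-zero spin vectors is the plus state: `⟪ι σ_A, ι σ_B⟫ = ⟨σ_{A ∆ B}⟩⁺_{β,h}`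
for `A, B ⊆ {x₀ = 0}` (time-zero observables embed isometrically for the site reflection;
Glimm–Jaffe §6.1 Remark). [cite: GlimmJaffe1987, §6.1 Remark (Transfer matrix of statistical physics)] -/
theorem inner_spinObs_spinObs_of_timeZero [DecidableEq (Site d)]
    (hR : IsingAxisOSRealisation d β h μ ι D) {A B : Finset (Site d)} (hA : ∀ x ∈ A, x 0 = 0)
    (hB : ∀ x ∈ B, x 0 = 0) :
    ⟪ι (spinObs A), ι (spinObs B)⟫_ℂ = (plusCorr d β h (A ∆ B) : ℂ) := by
  have hB' : (↑B : Set (Site d)) ⊆ positiveTimeSites d := fun x hx => by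
    simp only [positiveTimeSites, Set.mem_setOf_eq, hB x hx, le_refl]
  have := hR.inner_spinObs_transfer_pow_of_timeZero hA hB' 0
  simpa using this

omit [CompleteSpace H] in
/-- The vacuum expectation of a spin vector is the plus correlation: `⟪Ω, ι σ_B⟫ = ⟨σ_B⟩⁺_{β,h}` for
`B ⊆ {x₀ ≥ 0}` (`Ω = ι 1`). [cite: GlimmJaffe1987, §6.1  Theorem 6.1.3] -/
theorem inner_vacuum_spinObs (hR : IsingAxisOSRealisation d β h μ ι D) {B : Finset (Site d)}
    (hB : (↑B : Set (Site d)) ⊆ positiveTimeSites d) :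
    ⟪D.vacuum, ι (spinObs B)⟫_ℂ = (plusCorr d β h B : ℂ) := by
  rw [← hR.isOSRealisation.integral_eq_inner_vacuum (isBoundedMeasurable_spinObs hB), ← hR.spinCorr_eq,
    spinCorr, ← integral_complex_ofReal]
  rfl

end IsingAxisOSRealisation

end Literature.Probability.LatticeModels
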